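import Literature.AlgebraicGeometry.Frobenioids.Thm49Sub
import Literature.AlgebraicGeometry.Frobenioids.PullbackLinearSquares
import HarnessLib

/-!
# [FrdI] Theorem 4.9, proof step T49-L04: functoriality of `Ψ^Φ` along pull-back morphisms
# ("pulling back pre-steps", Prop. 1.11 (v)) — proofs

Mochizuki, *The geometry of Frobenioids I: the general theory*, Kyushu J. Math. **62** (2008)
293–400, §4, proof of Theorem 4.9, kurims text p. 89 ll. 25–36
[cite: MochizukiFrdI2008, Thm. 4.9 p.89] (render `paper:url-bbf705efa10f`):

> "[by] considering pre-steps `φ : A → B` with arbitrary prescribed zero divisor [Def. 1.3 (iii)(d)]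
> … one obtains an isomorphism of monoids `Φ₁(A₁) ≅ Φ₂(A₂)` … Moreover, the functoriality of this
> isomorphism of monoids with respect to pull-back morphisms follows immediately by "pulling back
> pre-steps", as in Proposition 1.11, (v)."

PROOF-ONLY companion of `Thm49Sub.lean` (row `FrdI:Thm4.9/T49-L04`, "the second clause of
`FrdI.T49.SufficesRightEqLeft`'s conclusion"). Nothing is defined or asserted; every hypothesis is
one of the tree's Def. 1.3 notions (`PreFrobenioid.IsFrobenioid`, `IsPullbackMorphism`,
`IsCoAngularPreStep`, `Div`, `Base`, `pull`) or the hypothesis structure `FrdI.T42.Setting`.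

What is proved (all sorry-free):

* `PreFrobenioid.div_eq_pull_div_of_pullback_square` — in a Frobenioid, a commutative square
  `α ≫ ψ = φ ≫ β` whose two parallel sides `φ`, `ψ` are pull-back morphisms satisfies
  `Div α = Base(φ)^* Div β` (Rem. 1.1.1 + Def. 1.3 (iv)(b): pull-back morphisms are isometric and
  linear). This is the divisor bookkeeping of "pulling back a pre-step".
* `PreFrobenioid.pull_natural_of_isPullbackMorphism` — **T49-L04**: if `G : C₁ ⥤ C₂` is a functor
  between Frobenioids preserving pull-back morphisms [Thm. 3.4 (iii)] and
  `m_A : Φ₁(A) → Φ₂(G A)` is ANY family of maps computing `m_A(Div φ) = Div(G φ)` for co-angular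
  pre-steps `φ` out of `A` (the defining property of `Ψ^Φ` on `Φ₁(A₁)`, p. 89 ll. 25–33), then `m` is
  natural along every pull-back morphism `φ : A → B`: `m_A(Base(φ)^* x) = Base(G φ)^* m_B(x)`.
  Proof = the printed one: realise `x = Div β` and `Base(φ)^* x = Div α` by co-angular pre-steps
  (Def. 1.3 (iii)(d)), complete to a square `α ≫ ψ = φ ≫ β` with `ψ` a pull-back morphism
  (Prop. 1.11 (v), coslice case: `PreFrobenioid.exists_pullback_square_under`), map the square by `G`
  and read off divisors in `C₂`.
* `PreFrobenioid.pull_natural_of_baseIso_of_pullback` — assembly used tacitly on p. 89 l. 33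
  ("functorial in `A₁` regarded as an object of `C₁^bs-iso`" + "with respect to pull-back
  morphisms" ⇒ functorial on `C₁`): naturality along base-isomorphisms and along pull-back morphisms
  give naturality along every morphism, via the factorisation
  `φ = (Frobenius-type) ≫ (pre-step) ≫ (pull-back)` of Def. 1.3 (iv)(a).
* `PreFrobenioid.eq_of_div_coAngularPreStep` — the family `m` is DETERMINED by the displayed property
  (Def. 1.3 (iii)(d), essential surjectivity), so any two constructions of `Ψ^Φ|Φ₁(A)` agree.
* `FrdI.T49.functorialPullbacks`, `FrdI.T49.natural_of_baseIso_natural` — the same in the exact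
  binders of `FrdI.T49.SufficesRightEqLeft` (a `T42.Setting F₁ F₂ Ψ`, a family of `≃*`, the pre-step
  clause of its conclusion): the pull-back clause, and the full second clause of the conclusion from
  its restriction to base-isomorphisms.

No statement of the paper is strengthened: the hypotheses of the main lemma (functor preserving
pull-back morphisms; divisor compatibility on co-angular pre-steps) are exactly what the printed
sentence invokes, and are implied by `T42.Setting.pullback_map` and the first clause of
`SufficesRightEqLeft`'s conclusion.
-/

namespace Literature.AlgebraicGeometry.Frobenioids

open CategoryTheory Opposite

universe w v v' u u'

namespace PreFrobenioid

section OneFrobenioid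

variable {D : Type u} [Category.{v} D] {Φ : Dᵒᵖ ⥤ CommMonCat.{w}}
  {C : Type u'} [Category.{v'} C] {F : C ⥤ ElemFrobenioid Φ}

/-- **Divisors in a pull-back square.** In a Frobenioid, if `α ≫ ψ = φ ≫ β` with `φ` and `ψ`
pull-back morphisms, then `Div α = Base(φ)^* Div β` (Rem. 1.1.1: `Div(ψ ∘ α) = Base(α)^*Div ψ +
deg_Fr(ψ)·Div α`, and pull-back morphisms have `Div = 0`, `deg_Fr = 1` by Def. 1.3 (iv)(b)).
[cite: MochizukiFrdI2008, Prop. 1.11(v) p.38] -/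
theorem div_eq_pull_div_of_pullback_square (hF : IsFrobenioid F) {A B X Y : C} {φ : A ⟶ B}
    {α : A ⟶ X} {β : B ⟶ Y} {ψ : X ⟶ Y} (hφ : IsPullbackMorphism F φ)
    (hψ : IsPullbackMorphism F ψ) (h : α ≫ ψ = φ ≫ β) :
    Div F α = pull Φ (Base F φ) (Div F β) := by
  obtain ⟨⟨-, hφiso⟩, -⟩ := hF.iv_b φ hφ
  obtain ⟨⟨-, hψiso⟩, hψlin⟩ := hF.iv_b ψ hψ
  have h1 : Div F (α ≫ ψ) = Div F α := by
    rw [div_comp, show Div F ψ = 1 from hψiso, map_one, one_mul, show degFr F ψ = 1 from hψlin,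
      PNat.one_coe, pow_one]
  have h2 : Div F (φ ≫ β) = pull Φ (Base F φ) (Div F β) := by
    rw [div_comp, show Div F φ = 1 from hφiso, one_pow, mul_one]
  rw [← h1, h, h2]

end OneFrobenioid

section TwoFrobenioids

variable {D₁ : Type u} [Category.{v} D₁] {Φ₁ : D₁ᵒᵖ ⥤ CommMonCat.{w}} {C₁ : Type u'}
  [Category.{v'} C₁] {D₂ : Type u} [Category.{v} D₂] {Φ₂ : D₂ᵒᵖ ⥤ CommMonCat.{w}} {C₂ : Type u'}
  [Category.{v'} C₂] {F₁ : C₁ ⥤ ElemFrobenioid Φ₁} {F₂ : C₂ ⥤ ElemFrobenioid Φ₂}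

/-- **[FrdI] Thm. 4.9, step T49-L04 ("pulling back pre-steps", Prop. 1.11 (v)).** Let
`G : C₁ → C₂` be a functor between Frobenioids which preserves pull-back morphisms
[Thm. 3.4 (iii)], and let `m_A : Φ₁(A) → Φ₂(G A)` (`A ∈ Ob(C₁)`) be any family of maps such that
`m_A(Div φ) = Div(G φ)` for every co-angular pre-step `φ` out of `A` (the property which defines
`Ψ^Φ` on `Φ₁(A₁)` via "pre-steps with prescribed zero divisor", Def. 1.3 (iii)(d)). Then `m` is
functorial with respect to pull-back morphisms: `m_A(Base(φ)^* x) = Base(G φ)^* m_B(x)` for every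
pull-back morphism `φ : A → B` and `x ∈ Φ₁(B)`. [cite: MochizukiFrdI2008, Thm. 4.9 p.89] -/
theorem pull_natural_of_isPullbackMorphism (hF₁ : IsFrobenioid F₁) (hF₂ : IsFrobenioid F₂)
    (G : C₁ ⥤ C₂)
    (hG : ∀ ⦃X Y : C₁⦄ (φ : X ⟶ Y), IsPullbackMorphism F₁ φ → IsPullbackMorphism F₂ (G.map φ))
    (m : ∀ A : C₁, Φ₁.obj (op (baseObj F₁ A)) → Φ₂.obj (op (baseObj F₂ (G.obj A))))
    (hm : ∀ ⦃A B : C₁⦄ (φ : A ⟶ B), IsCoAngularPreStep F₁ φ →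
      m A (Div F₁ φ) = Div F₂ (G.map φ))
    ⦃A B : C₁⦄ (φ : A ⟶ B) (hφ : IsPullbackMorphism F₁ φ) (x : Φ₁.obj (op (baseObj F₁ B))) :
    m A (pull Φ₁ (Base F₁ φ) x) = pull Φ₂ (Base F₂ (G.map φ)) (m B x) := by
  -- pre-steps with prescribed zero divisors `x` (out of `B`) and `Base(φ)^* x` (out of `A`)
  obtain ⟨Y, β, hβ, hβx⟩ := hF₁.iii_d_under_surj B x
  obtain ⟨X, α, hα, hαx⟩ := hF₁.iii_d_under_surj A (pull Φ₁ (Base F₁ φ) x)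
  -- "pulling back pre-steps" (Prop. 1.11 (v)): a square `α ≫ ψ = φ ≫ β`, `ψ` a pull-back morphism
  obtain ⟨ψ, hψ, hsq⟩ := exists_pullback_square_under hF₁ hφ α β hα hβ (by rw [hαx, hβx])
  have hsq₂ : G.map α ≫ G.map ψ = G.map φ ≫ G.map β := by rw [← G.map_comp, hsq, G.map_comp]
  rw [← hαx, ← hβx, hm α hα, hm β hβ]
  exact div_eq_pull_div_of_pullback_square hF₂ (hG φ hφ) (hG ψ hψ) hsq₂

/-- **Assembly (p. 89 l. 33: functorial on `C₁^bs-iso` and along pull-back morphisms ⇒ functorial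
on `C₁`).** For a functor `G : C₁ → C₂` out of a Frobenioid and any family `m_A : Φ₁(A) → Φ₂(G A)`,
naturality along base-isomorphisms together with naturality along pull-back morphisms imply
naturality along every morphism of `C₁` — every morphism factors as
`(Frobenius-type) ≫ (pre-step) ≫ (pull-back morphism)` (Def. 1.3 (iv)(a)) and the first two factors
are base-isomorphisms. [cite: MochizukiFrdI2008, Thm. 4.9 p.89] -/
theorem pull_natural_of_baseIso_of_pullback (hF₁ : IsFrobenioid F₁) (G : C₁ ⥤ C₂)
    (m : ∀ A : C₁, Φ₁.obj (op (baseObj F₁ A)) → Φ₂.obj (op (baseObj F₂ (G.obj A))))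
    (hbs : ∀ ⦃A B : C₁⦄ (φ : A ⟶ B), IsBaseIso F₁ φ → ∀ x : Φ₁.obj (op (baseObj F₁ B)),
      m A (pull Φ₁ (Base F₁ φ) x) = pull Φ₂ (Base F₂ (G.map φ)) (m B x))
    (hpb : ∀ ⦃A B : C₁⦄ (φ : A ⟶ B), IsPullbackMorphism F₁ φ → ∀ x : Φ₁.obj (op (baseObj F₁ B)),
      m A (pull Φ₁ (Base F₁ φ) x) = pull Φ₂ (Base F₂ (G.map φ)) (m B x))
    ⦃A B : C₁⦄ (φ : A ⟶ B) (x : Φ₁.obj (op (baseObj F₁ B))) :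
    m A (pull Φ₁ (Base F₁ φ) x) = pull Φ₂ (Base F₂ (G.map φ)) (m B x) := by
  obtain ⟨X, Y, γ, β, α, hφ, hγ, hβ, hα⟩ := hF₁.iv_a_exists φ
  subst hφ
  simp only [base_comp, pull_comp, Functor.map_comp]
  rw [hbs γ hγ.2, hbs β hβ.2, hpb α hα]

/-- **`Ψ^Φ|Φ₁(A)` is determined by pre-steps with prescribed zero divisor** (Def. 1.3 (iii)(d),
essential surjectivity): two families `m`, `m'` with `m_A(Div φ) = Div(G φ) = m'_A(Div φ)` for all
co-angular pre-steps `φ` out of `A` coincide. [cite: MochizukiFrdI2008, Thm. 4.9 p.89] -/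
theorem eq_of_div_coAngularPreStep (hF₁ : IsFrobenioid F₁) (G : C₁ ⥤ C₂)
    (m m' : ∀ A : C₁, Φ₁.obj (op (baseObj F₁ A)) → Φ₂.obj (op (baseObj F₂ (G.obj A))))
    (hm : ∀ ⦃A B : C₁⦄ (φ : A ⟶ B), IsCoAngularPreStep F₁ φ →
      m A (Div F₁ φ) = Div F₂ (G.map φ))
    (hm' : ∀ ⦃A B : C₁⦄ (φ : A ⟶ B), IsCoAngularPreStep F₁ φ →
      m' A (Div F₁ φ) = Div F₂ (G.map φ))
    (A : C₁) (x : Φ₁.obj (op (baseObj F₁ A))) : m A x = m' A x := by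
  obtain ⟨B, φ, hφ, hφx⟩ := hF₁.iii_d_under_surj A x
  rw [← hφx, hm φ hφ, hm' φ hφ]

/-- The two families even coincide as functions (pointwise form of
`eq_of_div_coAngularPreStep`). [cite: MochizukiFrdI2008, Thm. 4.9 p.89] -/
theorem funext_of_div_coAngularPreStep (hF₁ : IsFrobenioid F₁) (G : C₁ ⥤ C₂)
    (m m' : ∀ A : C₁, Φ₁.obj (op (baseObj F₁ A)) → Φ₂.obj (op (baseObj F₂ (G.obj A))))
    (hm : ∀ ⦃A B : C₁⦄ (φ : A ⟶ B), IsCoAngularPreStep F₁ φ →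
      m A (Div F₁ φ) = Div F₂ (G.map φ))
    (hm' : ∀ ⦃A B : C₁⦄ (φ : A ⟶ B), IsCoAngularPreStep F₁ φ →
      m' A (Div F₁ φ) = Div F₂ (G.map φ)) : m = m' :=
  funext fun A => funext fun x => eq_of_div_coAngularPreStep hF₁ G m m' hm hm' A x

end TwoFrobenioids

end PreFrobenioid

/-! ### In the binders of `FrdI.T49.SufficesRightEqLeft` -/

namespace FrdI.T49

variable {D₁ : Type u} [Category.{v} D₁] {Φ₁ : D₁ᵒᵖ ⥤ CommMonCat.{w}} {C₁ : Type u'}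
  [Category.{v'} C₁] {D₂ : Type u} [Category.{v} D₂] {Φ₂ : D₂ᵒᵖ ⥤ CommMonCat.{w}} {C₂ : Type u'}
  [Category.{v'} C₂] {F₁ : C₁ ⥤ ElemFrobenioid Φ₁} {F₂ : C₂ ⥤ ElemFrobenioid Φ₂} {Ψ : C₁ ≌ C₂}

/-- **T49-L04 `FunctorialPullbacks`, as it is consumed by `SufficesRightEqLeft`.** In a
`T42.Setting F₁ F₂ Ψ`, a family of monoid isomorphisms `m_A : Φ₁(A) ≃* Φ₂(Ψ A)` satisfying the
pre-step clause `m_A(Div φ) = Div(Ψ φ)` (first clause of the conclusion of `SufficesRightEqLeft`)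
is functorial with respect to pull-back morphisms (Prop. 1.11 (v); `Ψ` preserves pull-back
morphisms, Thm. 3.4 (iii) = `Setting.pullback_map`). [cite: MochizukiFrdI2008, Thm. 4.9 p.89] -/
theorem functorialPullbacks (S : T42.Setting F₁ F₂ Ψ)
    (m : ∀ A : C₁, Φ₁.obj (op (PreFrobenioid.baseObj F₁ A)) ≃*
      Φ₂.obj (op (PreFrobenioid.baseObj F₂ (Ψ.functor.obj A))))
    (hm : ∀ ⦃A B : C₁⦄ (φ : A ⟶ B), PreFrobenioid.IsPreStep F₁ φ →
      m A (PreFrobenioid.Div F₁ φ) = PreFrobenioid.Div F₂ (Ψ.functor.map φ))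
    ⦃A B : C₁⦄ (φ : A ⟶ B) (hφ : PreFrobenioid.IsPullbackMorphism F₁ φ)
    (x : Φ₁.obj (op (PreFrobenioid.baseObj F₁ B))) :
    m A (pull Φ₁ (PreFrobenioid.Base F₁ φ) x) =
      pull Φ₂ (PreFrobenioid.Base F₂ (Ψ.functor.map φ)) (m B x) :=
  PreFrobenioid.pull_natural_of_isPullbackMorphism S.isFrobenioid₁ S.isFrobenioid₂ Ψ.functor
    S.pullback_map (fun A => m A) (fun _ _ φ h => hm φ h.2) φ hφ x

/-- **The full second clause of `SufficesRightEqLeft`'s conclusion from its base-isomorphism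
part.** In a `T42.Setting F₁ F₂ Ψ`, if the family `m_A : Φ₁(A) ≃* Φ₂(Ψ A)` satisfies the pre-step
clause and is functorial in `A ∈ Ob(C₁^bs-iso)` (naturality along base-isomorphisms — the output of
rows T49-L02/L03), then it is functorial along every morphism of `C₁` (pull-back morphisms by
`functorialPullbacks`, then Def. 1.3 (iv)(a)). [cite: MochizukiFrdI2008, Thm. 4.9 p.89] -/
theorem natural_of_baseIso_natural (S : T42.Setting F₁ F₂ Ψ)
    (m : ∀ A : C₁, Φ₁.obj (op (PreFrobenioid.baseObj F₁ A)) ≃*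
      Φ₂.obj (op (PreFrobenioid.baseObj F₂ (Ψ.functor.obj A))))
    (hm : ∀ ⦃A B : C₁⦄ (φ : A ⟶ B), PreFrobenioid.IsPreStep F₁ φ →
      m A (PreFrobenioid.Div F₁ φ) = PreFrobenioid.Div F₂ (Ψ.functor.map φ))
    (hbs : ∀ ⦃A B : C₁⦄ (φ : A ⟶ B), PreFrobenioid.IsBaseIso F₁ φ →
      ∀ x : Φ₁.obj (op (PreFrobenioid.baseObj F₁ B)),
        m A (pull Φ₁ (PreFrobenioid.Base F₁ φ) x) =
          pull Φ₂ (PreFrobenioid.Base F₂ (Ψ.functor.map φ)) (m B x))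
    ⦃A B : C₁⦄ (φ : A ⟶ B) (x : Φ₁.obj (op (PreFrobenioid.baseObj F₁ B))) :
    m A (pull Φ₁ (PreFrobenioid.Base F₁ φ) x) =
      pull Φ₂ (PreFrobenioid.Base F₂ (Ψ.functor.map φ)) (m B x) :=
  PreFrobenioid.pull_natural_of_baseIso_of_pullback S.isFrobenioid₁ Ψ.functor (fun A => m A) hbs
    (functorialPullbacks S m hm) φ x

/-- **Packaging for `SufficesRightEqLeft`.** Given the pre-step clause and functoriality on
`C₁^bs-iso`, the family `m` satisfies BOTH clauses of the conclusion of
`FrdI.T49.SufficesRightEqLeft` (the `∃ m, … ∧ …` there is witnessed by `m`).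
[cite: MochizukiFrdI2008, Thm. 4.9 p.89] -/
theorem sufficesRightEqLeft_conclusion_of_baseIso_natural (S : T42.Setting F₁ F₂ Ψ)
    (m : ∀ A : C₁, Φ₁.obj (op (PreFrobenioid.baseObj F₁ A)) ≃*
      Φ₂.obj (op (PreFrobenioid.baseObj F₂ (Ψ.functor.obj A))))
    (hm : ∀ ⦃A B : C₁⦄ (φ : A ⟶ B), PreFrobenioid.IsPreStep F₁ φ →
      m A (PreFrobenioid.Div F₁ φ) = PreFrobenioid.Div F₂ (Ψ.functor.map φ))
    (hbs : ∀ ⦃A B : C₁⦄ (φ : A ⟶ B), PreFrobenioid.IsBaseIso F₁ φ →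
      ∀ x : Φ₁.obj (op (PreFrobenioid.baseObj F₁ B)),
        m A (pull Φ₁ (PreFrobenioid.Base F₁ φ) x) =
          pull Φ₂ (PreFrobenioid.Base F₂ (Ψ.functor.map φ)) (m B x)) :
    ∃ m : ∀ A : C₁, Φ₁.obj (op (PreFrobenioid.baseObj F₁ A)) ≃*
        Φ₂.obj (op (PreFrobenioid.baseObj F₂ (Ψ.functor.obj A))),
      (∀ ⦃A B : C₁⦄ (φ : A ⟶ B), PreFrobenioid.IsPreStep F₁ φ →
          m A (PreFrobenioid.Div F₁ φ) = PreFrobenioid.Div F₂ (Ψ.functor.map φ)) ∧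
      ∀ ⦃A B : C₁⦄ (φ : A ⟶ B) (x : Φ₁.obj (op (PreFrobenioid.baseObj F₁ B))),
        m A (pull Φ₁ (PreFrobenioid.Base F₁ φ) x) =
          pull Φ₂ (PreFrobenioid.Base F₂ (Ψ.functor.map φ)) (m B x) :=
  ⟨m, hm, natural_of_baseIso_natural S m hm hbs⟩

end FrdI.T49

end Literature.AlgebraicGeometry.Frobenioids
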